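import Summits.NavierStokesRegularity.NavierStokesRegularity.Theses.TypeILiouville
import Summits.NavierStokesRegularity.NavierStokesRegularity.Theorems.TypeILiouvilleTypeIliouvilleNoTypeIIOfWindowActivity
import Summits.NavierStokesRegularity.NavierStokesRegularity.Theorems.TypeILiouvilleTypeIliouvilleNoTypeIIStubGradientSharpOfTypeI
import Summits.NavierStokesRegularity.NavierStokesRegularity.Theorems.TypeILiouvilleTypeIliouvilleNoTypeIIStubThreeFifthsLaw
import Summits.NavierStokesRegularity.NavierStokesRegularity.Theorems.TypeILiouvilleTypeIliouvilleNoTypeIIStubEnergyBound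
import Literature.Analysis.FluidPDE.VectorCalculus
import HarnessLib

/-!
# `TypeIliouvilleNoTypeII` (stmt-NavierStokesRegularity-0056) ⇔ GradientBKMSharp ∧ WindowTypeI
# ⇔ GradientBKMSharp ∧ WindowActivity — the glue of the line `Sketch` (gradient-bkm-pivot), sorry-free

The crux `NoTypeII` (route `TypeILiouville`, rank 2; shared verbatim by 14 further routes): a
maximal smooth solution of Navier–Stokes on `ℝ³ × [0, T)` which is Leray–Hopf from a rapidly
decaying datum blows up at the Type I rate `‖u(t)‖_∞ ≤ C (T - t)^{-1/2}`.  This file lands the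
DICTIONARY of the line (pass c1 of the crux protocol) over its three landed stubs
`stub_gradientSharp_of_typeI` (p139164: Type-I velocity ⇒ `‖∇u(t)‖_∞ ≤ C/(T-t)`),
`stub_threeFifthsLaw` (p139256: `‖v‖_∞ ≤ C ‖v‖₂^{2/5} ‖∇v‖_∞^{3/5}`) and `stub_energyBound`
(p139029: `‖u(t)‖₂ ≤ ‖u(0)‖₂`), and the previous pass's `ImmortalZoom.stub_timeDoubling`,
`ImmortalZoom.stub_supNorm`:

* `velocityThreeFifths` — under gradient sharpness `‖∇u(t)‖_∞ ≤ C₁/(T-t)` the velocity obeys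
  `‖u(t)‖_∞ ≤ C₂/(T-t)^{3/5}` near `T` (Type-II excess exponent ≤ `1/10`: the finite-energy
  Euler window of velocity exponents is `[1/2, 3/5]`);
* `gradientSharp_of_noTypeII` — the crux implies **GradientBKMSharp** (A): every maximal
  Leray–Hopf solution from a rapidly decaying datum has `‖∇u(t)‖_∞ ≤ C/(T-t)` near `T`;
* `TypeIliouvilleNoTypeII_iff` = registered composition stub
  `stub_noTypeII_iff_gradientSharp_and_windowTypeI` — **`NoTypeII ⇔ A ∧ B`** with
  **WindowTypeI** (B): a gradient-sharp solution of the class obeying the 3/5 velocity bound is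
  Type I.  Both A and B are OPEN (the registered residual stubs `stub_gradientBKMSharp`,
  `stub_windowTypeI` of the skeleton `Cruxes/TypeIliouvilleNoTypeII/Lines/gradient_bkm_pivot.lean`);
  the crux is closed MODULO exactly these two, and each is necessary;
* `isTypeIBlowup_of_windowActivity_of_gradientSharp`, `windowActivity_of_isTypeIBlowup`,
  `TypeIliouvilleNoTypeII_iff_gradientSharp_and_windowActivity` — **`NoTypeII ⇔ A ∧ WindowActivity`**
  where WindowActivity is the previous pass's residual `stub_windowActivity` (v2, "no depleted
  Type-II blow-up"): on the gradient-sharp side window activity kills Type II by three lines of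
  arithmetic (an `ε`-active window of parameter `K` fitting before `T` has `K < C₁/ε`), so NO
  Liouville theorem — neither (L) nor the eternal Liouville residual of
  `TypeILiouvilleTypeIliouvilleNoTypeIIOfWindowActivity` — is needed once A is known.

Barrier bookkeeping (card gradient-bkm-pivot §Why-it-bites (1)): Tao's averaged Type-II blow-up
is gradient-Type-I, so it satisfies A and violates B; the averaging barrier
(`Literature.Barriers.NavierStokesRegularity.TaoAveragedBlowup`) therefore bites B only.
-/

noncomputable section

-- the summit and its single problem share the name `NavierStokesRegularity` (D-0017 nested layout)
set_option linter.dupNamespace false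

open Set Function Filter Topology MeasureTheory Metric
open scoped NNReal ENNReal

namespace Summit.NavierStokesRegularity.NavierStokesRegularity.Theorems.TypeIliouvilleNoTypeII.GradientPivot

open Literature.Analysis Literature.Analysis.FluidPDE
open Summit.NavierStokesRegularity.NavierStokesRegularity.Theorems.TypeIliouvilleNoTypeII.ImmortalZoom

/-- `ℝ³`. -/
local notation "E3" => EuclideanSpace ℝ (Fin 3)

/-! ## Glue -/

/-- An eventual statement at `T⁻` holds on a final interval `(t₀, T)`, `t₀ < T` (for `0 < T`;
`mem_nhdsLT_iff_exists_Ioo_subset`). [folklore] -/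
theorem exists_Ioo_of_eventually {T : ℝ} (hT : 0 < T) {P : ℝ → Prop} (h : ∀ᶠ t in 𝓝[<] T, P t) :
    ∃ t₀ < T, ∀ t ∈ Ioo t₀ T, P t := by
  obtain ⟨l, hl, hsub⟩ := mem_nhdsLT_iff_exists_Ioo_subset.1 h
  exact ⟨max l 0, max_lt hl hT, fun t ht => hsub ⟨(le_max_left _ _).trans_lt ht.1, ht.2⟩⟩

/-- **The 3/5 velocity bound under gradient sharpness** (STUBS 2 + 3): for a classical solution
on `[0, T)`, Leray–Hopf from its datum, `‖∇u(t)‖_∞ ≤ C₁/(T-t)` near `T` implies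
`‖u(t)‖_∞ ≤ C (∫‖u(0)‖²)^{1/5} C₁^{3/5} / (T-t)^{3/5}` near `T` — on the gradient-sharp side the
Type-II excess exponent is at most `3/5 - 1/2 = 1/10`. [folklore] -/
theorem velocityThreeFifths {ν T : ℝ} (hν : 0 < ν) (hT : 0 < T) {u : ℝ → E3 → E3} {p : ℝ → E3 → ℝ}
    (hsol : IsClassicalNSSolutionOn (Ico 0 T) ν 0 u p) (hLH : IsLerayHopfOn T ν 0 (u 0) u)
    (hG : ∃ C₁ : ℝ, ∀ᶠ t in 𝓝[<] T, ∀ x, ‖fderiv ℝ (u t) x‖ ≤ C₁ / (T - t)) :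
    ∃ C₂ : ℝ, ∀ᶠ t in 𝓝[<] T, ∀ x, ‖u t x‖ ≤ C₂ / (T - t) ^ (3 / 5 : ℝ) := by
  obtain ⟨C, hC, h35⟩ := stub_threeFifthsLaw
  obtain ⟨C₁, hC₁⟩ := hG
  have hE := stub_energyBound ν T hν u hLH
  set E₀ : ℝ := ∫ y, ‖u 0 y‖ ^ 2 with hE₀
  refine ⟨C * E₀ ^ (1 / 5 : ℝ) * (max C₁ 0) ^ (3 / 5 : ℝ), ?_⟩
  filter_upwards [hC₁, Ico_mem_nhdsLT hT] with t ht htI x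
  have hTt : 0 < T - t := sub_pos.2 htI.2
  -- the Lipschitz constant `L = max C₁ 0 / (T - t)` of the slice `u t`
  set L : ℝ := max C₁ 0 / (T - t) with hL
  have hL0 : 0 ≤ L := div_nonneg (le_max_right _ _) hTt.le
  have hgrad : ∀ y, ‖fderiv ℝ (u t) y‖ ≤ L := fun y =>
    (ht y).trans (div_le_div_of_nonneg_right (le_max_left _ _) hTt.le)
  have hdiff : Differentiable ℝ (u t) :=
    (hsol.contDiff_velocity htI).differentiable (by simp)
  obtain ⟨hmem, hle⟩ := hE t (Ico_subset_Icc_self htI)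
  have key := h35 (u t) L hdiff hmem hL0 hgrad x
  -- monotonicity in the energy and the algebra of real powers
  have hEt0 : 0 ≤ ∫ y, ‖u t y‖ ^ 2 := integral_nonneg fun y => by positivity
  have h1 : (∫ y, ‖u t y‖ ^ 2) ^ (1 / 5 : ℝ) ≤ E₀ ^ (1 / 5 : ℝ) :=
    Real.rpow_le_rpow hEt0 hle (by norm_num)
  have h2 : L ^ (3 / 5 : ℝ) = (max C₁ 0) ^ (3 / 5 : ℝ) / (T - t) ^ (3 / 5 : ℝ) := by
    rw [hL, Real.div_rpow (le_max_right _ _) hTt.le]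
  calc ‖u t x‖ ≤ C * (∫ y, ‖u t y‖ ^ 2) ^ (1 / 5 : ℝ) * L ^ (3 / 5 : ℝ) := key
    _ ≤ C * E₀ ^ (1 / 5 : ℝ) * L ^ (3 / 5 : ℝ) := by
        gcongr
    _ = C * E₀ ^ (1 / 5 : ℝ) * (max C₁ 0) ^ (3 / 5 : ℝ) / (T - t) ^ (3 / 5 : ℝ) := by
        rw [h2]; ring

/-- **Residual A is necessary** (STUB 1): the crux implies `GradientBKMSharp`. [folklore] -/
theorem gradientSharp_of_noTypeII
    (h : Summit.NavierStokesRegularity.NavierStokesRegularity.Theses.TypeILiouville.TypeIliouvilleNoTypeII)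
    (ν T : ℝ) (hν : 0 < ν) (hT : 0 < T) (u : ℝ → E3 → E3) (p : ℝ → E3 → ℝ)
    (hmax : IsMaximalSmoothSolution ν 0 u p T) (hLH : IsLerayHopfOn T ν 0 (u 0) u)
    (hdec : HasRapidSpatialDecay (u 0)) :
    ∃ C : ℝ, ∀ᶠ t in 𝓝[<] T, ∀ x, ‖fderiv ℝ (u t) x‖ ≤ C / (T - t) :=
  stub_gradientSharp_of_typeI ν T hν hT u p hmax.1 hLH hdec (h ν T hν hT u p hmax hLH hdec)

/-- **The transfer claim of the card as a theorem**: `NoTypeII ⇔ GradientBKMSharp ∧ WindowTypeI`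
(both conjuncts quantified over the crux's exact hypotheses; `→` by STUB 1, `←` by
`velocityThreeFifths`). [folklore] -/
theorem TypeIliouvilleNoTypeII_iff :
    Summit.NavierStokesRegularity.NavierStokesRegularity.Theses.TypeILiouville.TypeIliouvilleNoTypeII ↔
      ((∀ (ν T : ℝ), 0 < ν → 0 < T → ∀ (u : ℝ → E3 → E3) (p : ℝ → E3 → ℝ),
          IsMaximalSmoothSolution ν 0 u p T → IsLerayHopfOn T ν 0 (u 0) u →
          HasRapidSpatialDecay (u 0) →
          ∃ C : ℝ, ∀ᶠ t in 𝓝[<] T, ∀ x, ‖fderiv ℝ (u t) x‖ ≤ C / (T - t)) ∧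
        (∀ (ν T : ℝ), 0 < ν → 0 < T → ∀ (u : ℝ → E3 → E3) (p : ℝ → E3 → ℝ),
          IsMaximalSmoothSolution ν 0 u p T → IsLerayHopfOn T ν 0 (u 0) u →
          HasRapidSpatialDecay (u 0) →
          (∃ C₁ : ℝ, ∀ᶠ t in 𝓝[<] T, ∀ x, ‖fderiv ℝ (u t) x‖ ≤ C₁ / (T - t)) →
          (∃ C₂ : ℝ, ∀ᶠ t in 𝓝[<] T, ∀ x, ‖u t x‖ ≤ C₂ / (T - t) ^ (3 / 5 : ℝ)) →
          IsTypeIBlowup u T)) := by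
  constructor
  · intro h
    exact ⟨gradientSharp_of_noTypeII h, fun ν T hν hT u p hmax hLH hdec _ _ =>
      h ν T hν hT u p hmax hLH hdec⟩
  · rintro ⟨hA, hB⟩ ν T hν hT u p hmax hLH hdec
    have hG := hA ν T hν hT u p hmax hLH hdec
    exact hB ν T hν hT u p hmax hLH hdec hG (velocityThreeFifths hν hT hmax.1 hLH hG)

/-- **Window activity discharges residual B on the gradient-sharp side** — no Liouville theorem
needed.  If a maximal Leray–Hopf solution from a rapidly decaying datum is gradient-sharp
(`‖∇u(t)‖ ≤ C₁/(T-t)` near `T`) and satisfies the conclusion of the previous pass's residual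
`stub_windowActivity` (v2), it is Type I: otherwise `‖u(t)‖_∞ √(T-t)` is unbounded
(`ImmortalZoom.unbounded_of_not_isTypeIBlowup` with the modulus of `ImmortalZoom.stub_supNorm`),
the time doubling (`ImmortalZoom.stub_timeDoubling`) yields a long sup-controlled window of every
parameter `K` beyond every late `t₂`, window activity makes one of them `ε`-active,
`ε M² ≤ ν ‖∇u(t', x₀)‖ ≤ ν C₁/(T - t')`, while the window fits before `T`, `K ν/M² < T - t'`; hence
`K < C₁/ε` — absurd for `K ≥ C₁/ε + 1`. [folklore] -/
theorem isTypeIBlowup_of_windowActivity_of_gradientSharp {ν T : ℝ} (hν : 0 < ν) (hT : 0 < T)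
    {u : ℝ → E3 → E3} {p : ℝ → E3 → ℝ} (hmax : IsMaximalSmoothSolution ν 0 u p T)
    (hLH : IsLerayHopfOn T ν 0 (u 0) u) (hdec : HasRapidSpatialDecay (u 0))
    (hG : ∃ C₁ : ℝ, ∀ᶠ t in 𝓝[<] T, ∀ x, ‖fderiv ℝ (u t) x‖ ≤ C₁ / (T - t))
    (hWA : ∃ ε k₀ t₁ : ℝ, 0 < ε ∧ t₁ < T ∧ ∀ k t₂ : ℝ, k₀ ≤ k → t₁ ≤ t₂ → t₂ < T →
      (∃ t M : ℝ, t₂ < t ∧ 0 < M ∧ Icc (t - k * ν / M ^ 2) (t + k * ν / M ^ 2) ⊆ Ioo 0 T ∧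
        (∀ s ∈ Icc (t - k * ν / M ^ 2) (t + k * ν / M ^ 2), ∀ x, ‖u s x‖ ≤ 2 * M) ∧
        ∃ x, M ≤ 2 * ‖u t x‖) →
      ∃ t M : ℝ, ∃ x₀ : E3, t₂ < t ∧ 0 < M ∧
        Icc (t - k * ν / M ^ 2) (t + k * ν / M ^ 2) ⊆ Ioo 0 T ∧
        (∀ s ∈ Icc (t - k * ν / M ^ 2) (t + k * ν / M ^ 2), ∀ x, ‖u s x‖ ≤ M) ∧
        ε * M ^ 2 ≤ ν * ‖fderiv ℝ (u t) x₀‖) :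
    IsTypeIBlowup u T := by
  by_contra hII
  obtain ⟨m, hmc, hle, hnear, c, hc, hler⟩ := stub_supNorm ν T hν hT u p hmax hLH hdec
  obtain ⟨ε, k₀, t₁, hε, ht₁, hact⟩ := hWA
  obtain ⟨C₁, hC₁⟩ := hG
  obtain ⟨tg, htg, hgrad⟩ := exists_Ioo_of_eventually hT hC₁
  have hpos : ∀ t ∈ Ico 0 T, 0 < m t := fun t ht =>
    lt_of_lt_of_le (div_pos hc (Real.sqrt_pos.2 (by linarith [ht.2]))) (hler t ht)
  have hunb := unbounded_of_not_isTypeIBlowup hle hT hII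
  -- a long doubling window with parameter `K ≥ k₀, C₁/ε + 1, 1` beyond `t₂ = max (max t₁ 0) tg`
  set K : ℝ := max (max k₀ (C₁ / ε + 1)) 1 with hK
  have hK0 : 0 < K := lt_of_lt_of_le one_pos (le_max_right _ _)
  have hKν : 0 < Real.sqrt (K * ν) := Real.sqrt_pos.2 (mul_pos hK0 hν)
  set t₂ : ℝ := max (max t₁ 0) tg with ht₂
  have ht₂T : t₂ < T := max_lt (max_lt ht₁ hT) htg
  obtain ⟨t, ht, ht₂t, -, hleft, hright, hdoub⟩ :=
    stub_timeDoubling (k := Real.sqrt (K * ν)) hKν hmc hpos hunb t₂ ht₂T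
  have hMt : 0 < m t := hpos t ht
  have hsq : Real.sqrt (K * ν) ^ 2 = K * ν := Real.sq_sqrt (mul_pos hK0 hν).le
  rw [hsq] at hleft hright hdoub
  have hsub : Icc (t - K * ν / m t ^ 2) (t + K * ν / m t ^ 2) ⊆ Ioo 0 T := fun s hs =>
    ⟨lt_of_lt_of_le hleft hs.1, lt_of_le_of_lt hs.2 hright⟩
  have hbd : ∀ s ∈ Icc (t - K * ν / m t ^ 2) (t + K * ν / m t ^ 2), ∀ x, ‖u s x‖ ≤ 2 * m t := by
    intro s hs x
    have hsI : s ∈ Ico 0 T := ⟨(hsub hs).1.le, (hsub hs).2⟩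
    exact (hle s hsI x).trans (hdoub s hs)
  have hnr : ∃ x, m t ≤ 2 * ‖u t x‖ := by
    obtain ⟨x, hx⟩ := hnear t ht (m t / 2) (by linarith)
    exact ⟨x, by linarith⟩
  -- window activity: an `ε`-active sup-controlled window of parameter `K` beyond `t₂`
  obtain ⟨t', M, x₀, ht₂t', hM, hsub', -, hx₀⟩ := hact K t₂
    ((le_max_left _ _).trans (le_max_left _ _)) ((le_max_left _ _).trans (le_max_left _ _)) ht₂T
    ⟨t, m t, ht₂t, hMt, hsub, hbd, hnr⟩
  -- it fits before `T` …
  have hKM : 0 ≤ K * ν / M ^ 2 := by positivity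
  have hend := (hsub' ⟨by linarith, le_rfl⟩).2
  have ht'T : t' < T := by linarith
  have hTt' : 0 < T - t' := sub_pos.2 ht'T
  have hfit : K * ν < M ^ 2 * (T - t') := by
    have h1 : K * ν / M ^ 2 < T - t' := by linarith
    rw [div_lt_iff₀ (by positivity)] at h1
    linarith [mul_comm (T - t') (M ^ 2)]
  -- … and its centre is gradient-sharp
  have ht'g : t' ∈ Ioo tg T := ⟨(le_max_right _ _).trans_lt ht₂t', ht'T⟩
  have hsharp : ε * M ^ 2 ≤ ν * (C₁ / (T - t')) :=
    hx₀.trans (mul_le_mul_of_nonneg_left (hgrad t' ht'g x₀) hν.le)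
  have hsharp' : ε * (M ^ 2 * (T - t')) ≤ ν * C₁ := by
    have := mul_le_mul_of_nonneg_right hsharp hTt'.le
    rwa [mul_assoc, mul_assoc, div_mul_cancel₀ _ hTt'.ne'] at this
  -- hence `ε K ν < ν C₁`, i.e. `K < C₁/ε`, contradicting `C₁/ε + 1 ≤ K`
  have h1 : ε * (K * ν) < ν * C₁ := (mul_lt_mul_of_pos_left hfit hε).trans_le hsharp'
  have h2 : K < C₁ / ε := by
    rw [lt_div_iff₀ hε]
    nlinarith
  have h3 : C₁ / ε + 1 ≤ K := (le_max_right _ _).trans (le_max_left _ _)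
  linarith

/-- **`NoTypeII` from GradientBKMSharp and window activity** (residual A of this pass ∧ residual
`stub_windowActivity` v2 of the previous pass ⇒ the crux, stated UNFOLDED because v2 is not a stub
of this skeleton; neither (L) nor any eternal Liouville theorem is used). [folklore] -/
theorem noTypeII_of_gradientSharp_of_windowActivity
    (hA : ∀ (ν T : ℝ), 0 < ν → 0 < T → ∀ (u : ℝ → E3 → E3) (p : ℝ → E3 → ℝ),
      IsMaximalSmoothSolution ν 0 u p T → IsLerayHopfOn T ν 0 (u 0) u →
      HasRapidSpatialDecay (u 0) →
      ∃ C : ℝ, ∀ᶠ t in 𝓝[<] T, ∀ x, ‖fderiv ℝ (u t) x‖ ≤ C / (T - t))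
    (hWA : ∀ (ν T : ℝ), 0 < ν → 0 < T → ∀ (u : ℝ → E3 → E3) (p : ℝ → E3 → ℝ),
      IsMaximalSmoothSolution ν 0 u p T → IsLerayHopfOn T ν 0 (u 0) u →
      HasRapidSpatialDecay (u 0) →
      ∃ ε k₀ t₁ : ℝ, 0 < ε ∧ t₁ < T ∧ ∀ k t₂ : ℝ, k₀ ≤ k → t₁ ≤ t₂ → t₂ < T →
        (∃ t M : ℝ, t₂ < t ∧ 0 < M ∧ Icc (t - k * ν / M ^ 2) (t + k * ν / M ^ 2) ⊆ Ioo 0 T ∧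
          (∀ s ∈ Icc (t - k * ν / M ^ 2) (t + k * ν / M ^ 2), ∀ x, ‖u s x‖ ≤ 2 * M) ∧
          ∃ x, M ≤ 2 * ‖u t x‖) →
        ∃ t M : ℝ, ∃ x₀ : E3, t₂ < t ∧ 0 < M ∧
          Icc (t - k * ν / M ^ 2) (t + k * ν / M ^ 2) ⊆ Ioo 0 T ∧
          (∀ s ∈ Icc (t - k * ν / M ^ 2) (t + k * ν / M ^ 2), ∀ x, ‖u s x‖ ≤ M) ∧
          ε * M ^ 2 ≤ ν * ‖fderiv ℝ (u t) x₀‖) :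
    ∀ (ν T : ℝ), 0 < ν → 0 < T → ∀ (u : ℝ → E3 → E3) (p : ℝ → E3 → ℝ),
      IsMaximalSmoothSolution ν 0 u p T → IsLerayHopfOn T ν 0 (u 0) u →
      HasRapidSpatialDecay (u 0) → IsTypeIBlowup u T :=
  fun ν T hν hT u p hmax hLH hdec =>
    isTypeIBlowup_of_windowActivity_of_gradientSharp hν hT hmax hLH hdec
      (hA ν T hν hT u p hmax hLH hdec) (hWA ν T hν hT u p hmax hLH hdec)

/-- **Window activity is necessary too**: a Type-I blow-up satisfies the conclusion of
`stub_windowActivity` (v2) vacuously — under `‖u(t)‖ ≤ C₀/√(T-t)` near `T` a sup-controlled window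
of parameter `k` with `M ≤ 2‖u(t,x)‖` fitting before `T` has `k ν < M²(T-t) ≤ 4 C₀²`, so none
exists once `k ≥ 4C₀²/ν + 1`. [folklore] -/
theorem windowActivity_of_isTypeIBlowup {ν T : ℝ} (hν : 0 < ν) (hT : 0 < T) {u : ℝ → E3 → E3}
    (hI : IsTypeIBlowup u T) :
    ∃ ε k₀ t₁ : ℝ, 0 < ε ∧ t₁ < T ∧ ∀ k t₂ : ℝ, k₀ ≤ k → t₁ ≤ t₂ → t₂ < T →
      (∃ t M : ℝ, t₂ < t ∧ 0 < M ∧ Icc (t - k * ν / M ^ 2) (t + k * ν / M ^ 2) ⊆ Ioo 0 T ∧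
        (∀ s ∈ Icc (t - k * ν / M ^ 2) (t + k * ν / M ^ 2), ∀ x, ‖u s x‖ ≤ 2 * M) ∧
        ∃ x, M ≤ 2 * ‖u t x‖) →
      ∃ t M : ℝ, ∃ x₀ : E3, t₂ < t ∧ 0 < M ∧
        Icc (t - k * ν / M ^ 2) (t + k * ν / M ^ 2) ⊆ Ioo 0 T ∧
        (∀ s ∈ Icc (t - k * ν / M ^ 2) (t + k * ν / M ^ 2), ∀ x, ‖u s x‖ ≤ M) ∧
        ε * M ^ 2 ≤ ν * ‖fderiv ℝ (u t) x₀‖ := by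
  obtain ⟨C₀, hC₀⟩ := hI
  obtain ⟨tI, htI, hbound⟩ := exists_Ioo_of_eventually hT hC₀
  refine ⟨1, 4 * (max C₀ 0) ^ 2 / ν + 1, tI, one_pos, htI, ?_⟩
  rintro k t₂ hk ht₂ - ⟨t, M, ht₂t, hM, hsub, -, x, hx⟩
  exfalso
  have hk0 : 0 ≤ k := by
    have : 0 ≤ 4 * (max C₀ 0) ^ 2 / ν := by positivity
    linarith
  have hkM : 0 ≤ k * ν / M ^ 2 := by positivity
  have htc : t ∈ Icc (t - k * ν / M ^ 2) (t + k * ν / M ^ 2) := ⟨by linarith, by linarith⟩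
  have htT : t < T := (hsub htc).2
  have hTt : 0 < T - t := sub_pos.2 htT
  have hend := (hsub ⟨by linarith, le_rfl⟩).2
  -- the window fits before `T`: `k ν < M² (T - t)`
  have hfit : k * ν < M ^ 2 * (T - t) := by
    have h1 : k * ν / M ^ 2 < T - t := by linarith
    rw [div_lt_iff₀ (by positivity)] at h1
    linarith [mul_comm (T - t) (M ^ 2)]
  -- the Type-I bound at the near-maximum point: `M √(T - t) ≤ 2 C₀ ≤ 2 max C₀ 0`
  have hux : ‖u t x‖ ≤ C₀ / Real.sqrt (T - t) := hbound t ⟨ht₂.trans_lt ht₂t |>.trans_le' le_rfl, htT⟩ x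
  have hs : 0 < Real.sqrt (T - t) := Real.sqrt_pos.2 hTt
  have hMs : M * Real.sqrt (T - t) ≤ 2 * max C₀ 0 := by
    have h1 : M ≤ 2 * (C₀ / Real.sqrt (T - t)) := hx.trans (by linarith)
    have h2 : M * Real.sqrt (T - t) ≤ 2 * C₀ := by
      have := mul_le_mul_of_nonneg_right h1 hs.le
      rwa [mul_assoc, div_mul_cancel₀ _ hs.ne'] at this
    linarith [le_max_left C₀ 0]
  have hM2 : M ^ 2 * (T - t) ≤ 4 * (max C₀ 0) ^ 2 := by
    have h0 : 0 ≤ M * Real.sqrt (T - t) := by positivity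
    have h1 := mul_le_mul hMs hMs h0 (by positivity)
    have h2 : M * Real.sqrt (T - t) * (M * Real.sqrt (T - t)) = M ^ 2 * (T - t) := by
      rw [mul_mul_mul_comm, ← pow_two, ← pow_two, Real.sq_sqrt hTt.le]
    nlinarith [h1, h2]
  -- `k ν < 4 (max C₀ 0)²`, i.e. `k < 4 (max C₀ 0)²/ν < k₀ ≤ k`
  have h1 : k * ν < 4 * (max C₀ 0) ^ 2 := hfit.trans_le hM2
  have h2 : k < 4 * (max C₀ 0) ^ 2 / ν := by rwa [lt_div_iff₀ hν]
  linarith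

/-- **The crux is also equivalent to GradientBKMSharp ∧ WindowActivity (v2)** — both conjuncts
necessary (`gradientSharp_of_noTypeII`, `windowActivity_of_isTypeIBlowup`), jointly sufficient
(`noTypeII_of_gradientSharp_of_windowActivity`). [folklore] -/
theorem TypeIliouvilleNoTypeII_iff_gradientSharp_and_windowActivity :
    Summit.NavierStokesRegularity.NavierStokesRegularity.Theses.TypeILiouville.TypeIliouvilleNoTypeII ↔
      ((∀ (ν T : ℝ), 0 < ν → 0 < T → ∀ (u : ℝ → E3 → E3) (p : ℝ → E3 → ℝ),
          IsMaximalSmoothSolution ν 0 u p T → IsLerayHopfOn T ν 0 (u 0) u →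
          HasRapidSpatialDecay (u 0) →
          ∃ C : ℝ, ∀ᶠ t in 𝓝[<] T, ∀ x, ‖fderiv ℝ (u t) x‖ ≤ C / (T - t)) ∧
        (∀ (ν T : ℝ), 0 < ν → 0 < T → ∀ (u : ℝ → E3 → E3) (p : ℝ → E3 → ℝ),
          IsMaximalSmoothSolution ν 0 u p T → IsLerayHopfOn T ν 0 (u 0) u →
          HasRapidSpatialDecay (u 0) →
          ∃ ε k₀ t₁ : ℝ, 0 < ε ∧ t₁ < T ∧ ∀ k t₂ : ℝ, k₀ ≤ k → t₁ ≤ t₂ → t₂ < T →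
            (∃ t M : ℝ, t₂ < t ∧ 0 < M ∧
              Icc (t - k * ν / M ^ 2) (t + k * ν / M ^ 2) ⊆ Ioo 0 T ∧
              (∀ s ∈ Icc (t - k * ν / M ^ 2) (t + k * ν / M ^ 2), ∀ x, ‖u s x‖ ≤ 2 * M) ∧
              ∃ x, M ≤ 2 * ‖u t x‖) →
            ∃ t M : ℝ, ∃ x₀ : E3, t₂ < t ∧ 0 < M ∧
              Icc (t - k * ν / M ^ 2) (t + k * ν / M ^ 2) ⊆ Ioo 0 T ∧
              (∀ s ∈ Icc (t - k * ν / M ^ 2) (t + k * ν / M ^ 2), ∀ x, ‖u s x‖ ≤ M) ∧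
              ε * M ^ 2 ≤ ν * ‖fderiv ℝ (u t) x₀‖)) := by
  constructor
  · intro h
    exact ⟨gradientSharp_of_noTypeII h, fun ν T hν hT u p hmax hLH hdec =>
      windowActivity_of_isTypeIBlowup hν hT (h ν T hν hT u p hmax hLH hdec)⟩
  · rintro ⟨hA, hWA⟩
    exact noTypeII_of_gradientSharp_of_windowActivity hA hWA

/-! ## Registered composition stub -/

/-- **Registered composition stub of the line `Sketch` (gradient-bkm-pivot), crux
`TypeIliouvilleNoTypeII` (stmt-NavierStokesRegularity-0056)**: `NoTypeII ⇔ GradientBKMSharp ∧ WindowTypeI`,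
i.e. the crux is closed MODULO exactly the two residual stubs `stub_gradientBKMSharp` (A) and
`stub_windowTypeI` (B) of the skeleton, and conversely each residual is necessary. [folklore] -/
theorem stub_noTypeII_iff_gradientSharp_and_windowTypeI :
    Summit.NavierStokesRegularity.NavierStokesRegularity.Theses.TypeILiouville.TypeIliouvilleNoTypeII ↔
      ((∀ (ν T : ℝ), 0 < ν → 0 < T → ∀ (u : ℝ → E3 → E3) (p : ℝ → E3 → ℝ),
          IsMaximalSmoothSolution ν 0 u p T → IsLerayHopfOn T ν 0 (u 0) u →
          HasRapidSpatialDecay (u 0) →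
          ∃ C : ℝ, ∀ᶠ t in 𝓝[<] T, ∀ x, ‖fderiv ℝ (u t) x‖ ≤ C / (T - t)) ∧
        (∀ (ν T : ℝ), 0 < ν → 0 < T → ∀ (u : ℝ → E3 → E3) (p : ℝ → E3 → ℝ),
          IsMaximalSmoothSolution ν 0 u p T → IsLerayHopfOn T ν 0 (u 0) u →
          HasRapidSpatialDecay (u 0) →
          (∃ C₁ : ℝ, ∀ᶠ t in 𝓝[<] T, ∀ x, ‖fderiv ℝ (u t) x‖ ≤ C₁ / (T - t)) →
          (∃ C₂ : ℝ, ∀ᶠ t in 𝓝[<] T, ∀ x, ‖u t x‖ ≤ C₂ / (T - t) ^ (3 / 5 : ℝ)) →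
          IsTypeIBlowup u T)) :=
  TypeIliouvilleNoTypeII_iff

end Summit.NavierStokesRegularity.NavierStokesRegularity.Theorems.TypeIliouvilleNoTypeII.GradientPivot

end
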